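import Literature.NumberTheory.Transcendental.GammaIsoTransfer
import HarnessLib

/-!
# One-step extensions of Γ-isomorphisms, I: algebraic elements (Bays–Kirby 2018, §4.4)

Toolkit for the proof of Bays–Kirby 2018, Prop. 11.2 (`Literature.NumberTheory.Transcendental.BaysKirby2018_prop_11_2`),
exponential case inside a fixed exponential field `F` (M. Bays, J. Kirby, *Pseudo-exponential
maps, variants, and quasiminimality*, Algebra & Number Theory 12 (2018), arXiv:1512.04262).

The reduction "we may assume `A = A^full ∧ B`" in the proof of Lemma 8.3 (p. 26, invoked by
Prop. 11.2) embeds the part of `B` lying in the full closure of `A` into `F` first; by the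
existence-and-uniqueness theorem for full closures (Thm 4.17, §4.4, pp. 16–17) this is done one
element at a time. This file treats the **algebraic step**: `c ↦ c'` a Γ-isomorphism over `K`
(`GammaField.IsGammaIso`) between strong subspaces `K + ℚc ◁ F`, `K + ℚc' ◁ F`, and `x ∉ K + ℚc`
*algebraic* over the Γ-field `A = ⟨K c⟩`. Then (`IsGammaIso.exists_append_single_of_mem_acl`)
there is `x'` with `(c, x) ↦ (c', x')` a Γ-isomorphism over `K`, `x' ∉ K + ℚc'` algebraic over
`⟨K c'⟩`; moreover `δ(x/A) = 0`, so `K + ℚc + ℚx ◁ F` (Lemma 4.8), and likewise on the target.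

Proof (Thm 4.17, proof, algebraic case): `x'` is any root of the transport `θ(q)` of the minimal
polynomial `q` of `x` over `A` along the field isomorphism `θ : ⟨K c⟩ ≅ ⟨K c'⟩`
(`IsGammaIso.fieldEquiv`). At level `M`, the relation ideal over `K₀` of
`(c, x ; exp (c/M!), exp (x/M!))` is determined by that of `(c ; exp (c/M!))` together with `q`,
because `exp (x/M!)` is transcendental over `K₀[c, exp (c/M!), x]`: `A ◁ F` gives
`td(x, exp x/A) ≥ 1` while `x` is algebraic (`exp_not_mem_acl_of_mem_acl`); equal relation ideals
at every level is `isGammaIso_iff_ker_eq`.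

## Contents

* δ-bookkeeping for elements of the full closure: `td_span_singleton_le_one_of_mem_acl`,
  `td_span_singleton_eq_one_of_mem_acl`, `predim_span_singleton_eq_zero_of_mem_acl`,
  `exp_not_mem_acl_of_mem_acl`, `isStrong_sup_span_singleton_of_mem_acl`, and the logarithmic
  analogues `…_of_exp_mem_acl` (used by the logarithmic step).
* `isAlgebraic_of_mem_acl_of_subset` — bridge from the algebraic matroid (`GammaField.acl`) to
  `IsAlgebraic` over an intermediate field.
* `IsGammaIso.aeval_sumElim_single_eq_zero_iff` — transport of the type of an algebraic element
  along `θ`; `IsGammaIso.append_single_of_minpoly` — the Γ-isomorphism `(c, x) ↦ (c', x')`;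
  `IsGammaIso.exists_append_single_of_mem_acl` — existence of `x'` (for `F` algebraically closed).

## References

* M. Bays, J. Kirby, *Pseudo-exponential maps, variants, and quasiminimality*, Algebra & Number
  Theory 12 (2018) 493–549: Def. 4.1, Lemma 4.8, §4.4 (Thm 4.17 and its proof), Lemma 8.3
  (proof), Prop. 11.2.
-/

noncomputable section

open Set MvPolynomial

namespace Literature.NumberTheory.Transcendental

namespace GammaField

open Literature.ModelTheory.ExponentialFields.ExponentialRing ZilberHomogeneity

variable {F : Type*} [Field F] [CharZero F] [Literature.ModelTheory.ExponentialFields.ExponentialRing F]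
variable {K : Submodule ℚ F} {N : ℕ}

/-! ### δ-bookkeeping for algebraic elements and logarithms of algebraic elements -/

section Bookkeeping

variable {Λ : Submodule ℚ F} {x : F}

/-- If `x` is algebraic over the Γ-field of `Λ` then `td(x, exp x/Λ) ≤ 1`. [folklore] -/
theorem td_span_singleton_le_one_of_mem_acl (hx : x ∈ acl (gens Λ)) :
    td Λ (Submodule.span ℚ {x}) ≤ 1 := by
  rw [td_span_singleton]
  have h1 : (algMatroid F).relRank (gens Λ) {x, exp x} = (algMatroid F).relRank (gens Λ) {exp x} :=
    (algMatroid F).relRank_insert_eq_of_mem_closure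
      ((algMatroid F).closure_subset_closure subset_union_right hx)
  rw [h1]
  exact ((algMatroid F).relRank_le_encard_diff _ _).trans
    ((encard_le_encard sdiff_subset).trans (by rw [encard_singleton]))

/-- If `exp x` is algebraic over the Γ-field of `Λ` then `td(x, exp x/Λ) ≤ 1`. [folklore] -/
theorem td_span_singleton_le_one_of_exp_mem_acl (hx : exp x ∈ acl (gens Λ)) :
    td Λ (Submodule.span ℚ {x}) ≤ 1 := by
  rw [td_span_singleton, pair_comm]
  have h1 : (algMatroid F).relRank (gens Λ) {exp x, x} = (algMatroid F).relRank (gens Λ) {x} :=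
    (algMatroid F).relRank_insert_eq_of_mem_closure
      ((algMatroid F).closure_subset_closure subset_union_right hx)
  rw [h1]
  exact ((algMatroid F).relRank_le_encard_diff _ _).trans
    ((encard_le_encard sdiff_subset).trans (by rw [encard_singleton]))

/-- Over a strong `Λ`, an element `x ∉ Λ` with `td(x, exp x/Λ) ≤ 1` has `td = 1` and `δ(x/Λ) = 0`.
[cite: BaysKirby2018ANT, Def. 4.1, Def. 4.3] -/
theorem td_eq_one_and_predim_eq_zero_of_td_le_one (hs : IsStrong Λ) (hxΛ : x ∉ Λ)
    (h1 : td Λ (Submodule.span ℚ {x}) ≤ 1) :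
    td Λ (Submodule.span ℚ {x}) = 1 ∧ predim Λ (Submodule.span ℚ {x}) = 0 := by
  have h0 : 0 ≤ predim Λ (Submodule.span ℚ {x}) :=
    isStrong_iff.1 hs _ (isFG_span_of_finite Λ (finite_singleton x))
  rw [predim, ldim_span_singleton_of_not_mem hxΛ] at h0 ⊢
  have hne : td Λ (Submodule.span ℚ {x}) ≠ ⊤ := ne_top_of_le_ne_top (by decide) h1
  have hle : (td Λ (Submodule.span ℚ {x})).toNat ≤ 1 := ENat.toNat_le_of_le_coe h1
  have hge : 1 ≤ (td Λ (Submodule.span ℚ {x})).toNat := by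
    have : (1 : ℤ) ≤ ((td Λ (Submodule.span ℚ {x})).toNat : ℤ) := by push_cast at h0 ⊢; omega
    exact_mod_cast this
  have heq : (td Λ (Submodule.span ℚ {x})).toNat = 1 := le_antisymm hle hge
  refine ⟨?_, by rw [heq]; norm_num⟩
  rw [← ENat.coe_toNat hne, heq]; rfl

/-- **Algebraic elements over a strong subspace**: if `Λ ◁ F`, `x ∉ Λ` and `x` is algebraic over
the Γ-field of `Λ`, then `td(x, exp x/Λ) = 1` (so `exp x` is transcendental over `A(x)`) and
`δ(x/Λ) = 0`. [cite: BaysKirby2018ANT, §4.4 (Thm 4.17, proof)] -/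
theorem td_eq_one_of_mem_acl (hs : IsStrong Λ) (hx : x ∈ acl (gens Λ)) (hxΛ : x ∉ Λ) :
    td Λ (Submodule.span ℚ {x}) = 1 ∧ predim Λ (Submodule.span ℚ {x}) = 0 :=
  td_eq_one_and_predim_eq_zero_of_td_le_one hs hxΛ (td_span_singleton_le_one_of_mem_acl hx)

/-- **Logarithms of algebraic elements over a strong subspace**: if `Λ ◁ F`, `x ∉ Λ` and `exp x`
is algebraic over the Γ-field of `Λ`, then `td(x, exp x/Λ) = 1` and `δ(x/Λ) = 0`.
[cite: BaysKirby2018ANT, §4.4 (Thm 4.17, proof)] -/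
theorem td_eq_one_of_exp_mem_acl (hs : IsStrong Λ) (hx : exp x ∈ acl (gens Λ)) (hxΛ : x ∉ Λ) :
    td Λ (Submodule.span ℚ {x}) = 1 ∧ predim Λ (Submodule.span ℚ {x}) = 0 :=
  td_eq_one_and_predim_eq_zero_of_td_le_one hs hxΛ (td_span_singleton_le_one_of_exp_mem_acl hx)

/-- If `Λ ◁ F`, `x ∉ Λ` is algebraic over the Γ-field of `Λ`, then `exp x` is *not* algebraic
over that field with `x` adjoined: `exp x ∉ acl (gens Λ ∪ {x})`. [cite: BaysKirby2018ANT, §4.4 (Thm 4.17, proof)] -/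
theorem exp_not_mem_acl_of_mem_acl (hs : IsStrong Λ) (hx : x ∈ acl (gens Λ)) (hxΛ : x ∉ Λ) :
    exp x ∉ acl (insert x (gens Λ)) := by
  intro hex
  have h1 := (td_eq_one_of_mem_acl hs hx hxΛ).1
  rw [td_span_singleton, pair_comm] at h1
  have h2 : (algMatroid F).relRank (gens Λ) {exp x, x} = (algMatroid F).relRank (gens Λ) {x} :=
    (algMatroid F).relRank_insert_eq_of_mem_closure (by rwa [singleton_union])
  have h3 : (algMatroid F).relRank (gens Λ) {x} = 0 :=
    (algMatroid F).relRank_eq_zero_of_subset_closure (singleton_subset_iff.2 hx)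
  rw [h2, h3] at h1
  exact zero_ne_one h1

/-- If `Λ ◁ F`, `x ∉ Λ` and `exp x` is algebraic over the Γ-field of `Λ`, then `x` is transcendental
over that field (even with `exp x` adjoined): `x ∉ acl (gens Λ ∪ {exp x})`.
[cite: BaysKirby2018ANT, §4.4 (Thm 4.17, proof)] -/
theorem not_mem_acl_of_exp_mem_acl (hs : IsStrong Λ) (hx : exp x ∈ acl (gens Λ)) (hxΛ : x ∉ Λ) :
    x ∉ acl (insert (exp x) (gens Λ)) := by
  intro hxa
  have h1 := (td_eq_one_of_exp_mem_acl hs hx hxΛ).1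
  rw [td_span_singleton] at h1
  have h2 : (algMatroid F).relRank (gens Λ) {x, exp x} = (algMatroid F).relRank (gens Λ) {exp x} :=
    (algMatroid F).relRank_insert_eq_of_mem_closure (by rwa [singleton_union])
  have h3 : (algMatroid F).relRank (gens Λ) {exp x} = 0 :=
    (algMatroid F).relRank_eq_zero_of_subset_closure (singleton_subset_iff.2 hx)
  rw [h2, h3] at h1
  exact zero_ne_one h1

/-- **Lemma 4.8 for one algebraic element**: `Λ ◁ F`, `x ∉ Λ` algebraic over the Γ-field of `Λ`
`⟹ Λ + ℚx ◁ F`. [cite: BaysKirby2018ANT, Lemma 4.8] -/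
theorem isStrong_sup_span_singleton_of_mem_acl (hs : IsStrong Λ) (hx : x ∈ acl (gens Λ))
    (hxΛ : x ∉ Λ) : IsStrong (Λ ⊔ Submodule.span ℚ {x}) :=
  hs.of_predim_eq_zero le_sup_left (isFG_sup_left.2 (isFG_span_of_finite Λ (finite_singleton x)))
    (by rw [predim_sup_left]; exact (td_eq_one_of_mem_acl hs hx hxΛ).2)

/-- **Lemma 4.8 for one logarithm of an algebraic element**: `Λ ◁ F`, `x ∉ Λ` with `exp x`
algebraic over the Γ-field of `Λ` `⟹ Λ + ℚx ◁ F`. [cite: BaysKirby2018ANT, Lemma 4.8] -/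
theorem isStrong_sup_span_singleton_of_exp_mem_acl (hs : IsStrong Λ) (hx : exp x ∈ acl (gens Λ))
    (hxΛ : x ∉ Λ) : IsStrong (Λ ⊔ Submodule.span ℚ {x}) :=
  hs.of_predim_eq_zero le_sup_left (isFG_sup_left.2 (isFG_span_of_finite Λ (finite_singleton x)))
    (by rw [predim_sup_left]; exact (td_eq_one_of_exp_mem_acl hs hx hxΛ).2)

end Bookkeeping

/-! ### From the algebraic matroid to algebraicity over an intermediate field -/

section Bridge

omit [Literature.ModelTheory.ExponentialFields.ExponentialRing F] in
/-- The `ℚ`-subalgebra generated by a subset of an intermediate field lies in it (as sets).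
[folklore] -/
theorem coe_adjoin_rat_subset {k : Type*} [Field k] [Algebra k F] (S : IntermediateField k F)
    {s : Set F} (hs : s ⊆ S) : ((Algebra.adjoin ℚ s : Subalgebra ℚ F) : Set F) ⊆ S := by
  intro z hz
  induction hz using Algebra.adjoin_induction with
  | mem z hz => exact hs hz
  | algebraMap q => exact SubfieldClass.ratCast_mem S q
  | add z w _ _ hz hw => exact add_mem hz hw
  | mul z w _ _ hz hw => exact mul_mem hz hw

omit [Literature.ModelTheory.ExponentialFields.ExponentialRing F] in
/-- **Bridge**: an element of `acl s` is algebraic over every intermediate field containing `s`.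
[folklore] -/
theorem isAlgebraic_of_mem_acl_of_subset {k : Type*} [Field k] [Algebra k F]
    (S : IntermediateField k F) {s : Set F} (hs : s ⊆ S) {x : F} (hx : x ∈ acl s) :
    IsAlgebraic S x := by
  rw [mem_acl_iff] at hx
  have hle := coe_adjoin_rat_subset S hs
  let φ : Algebra.adjoin ℚ s →+* S :=
    (algebraMap (Algebra.adjoin ℚ s) F).codRestrict S fun z => hle z.2
  have hφ : Function.Injective φ := fun a b hab =>
    Subtype.ext (congrArg Subtype.val hab : ((φ a : S) : F) = φ b)
  have := hx.ringHom_of_comp_eq φ (RingHom.id F) hφ (by ext z; rfl)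
  simpa using this

omit [Literature.ModelTheory.ExponentialFields.ExponentialRing F] in
/-- An element algebraic over an intermediate field lies in `acl` of its carrier
(`ZilberHomogeneity.mem_acl_of_isAlgebraic` for intermediate fields). [folklore] -/
theorem mem_acl_coe_of_isAlgebraic {k : Type*} [Field k] [Algebra k F] (S : IntermediateField k F)
    {x : F} (hx : IsAlgebraic S x) : x ∈ acl (S : Set F) :=
  mem_acl_of_isAlgebraic S.toSubalgebra hx

end Bridge

/-! ### The Γ-field `⟨K c⟩` as an intermediate field: generators and `acl` -/

section GammaFieldOf

variable (K) in
/-- `gens (K + ℚc) ⊆ K₀(allGens c)` (the latter is the Γ-field `⟨K c⟩`). [folklore] -/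
theorem gens_sup_span_subset_adjoinField (c : Fin N → F) :
    gens (K ⊔ Submodule.span ℚ (range c)) ⊆
      (IntermediateField.adjoin (fieldOf K) (allGens c) : Set F) := by
  rintro z (hz | ⟨y, hy, rfl⟩)
  · exact mem_adjoinField_of_mem_sup hz
  · exact exp_mem_adjoinField_of_mem hy

variable (K) in
/-- `acl ⟨K c⟩ = acl (gens (K + ℚc))`. [folklore] -/
theorem acl_coe_adjoinField_eq (c : Fin N → F) :
    acl ((IntermediateField.adjoin (fieldOf K) (allGens c) : Set F)) =
      acl (gens (K ⊔ Submodule.span ℚ (range c))) := by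
  have : ((IntermediateField.adjoin (fieldOf K) (allGens c) : Set F)) =
      (fieldOf (K ⊔ Submodule.span ℚ (range c)) : Set F) := by
    ext z; exact mem_adjoinField_allGens_iff K c
  rw [this, acl_fieldOf]

/-- Elements of `acl (gens (K + ℚc))` are integral over `⟨K c⟩`. [folklore] -/
theorem isIntegral_adjoinField_of_mem_acl {c : Fin N → F} {x : F}
    (hx : x ∈ acl (gens (K ⊔ Submodule.span ℚ (range c)))) :
    IsIntegral (IntermediateField.adjoin (fieldOf K) (allGens c)) x :=
  (isAlgebraic_of_mem_acl_of_subset _ (gens_sup_span_subset_adjoinField K c) hx).isIntegral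

/-- The level generators lie in `⟨K c⟩`. [folklore] -/
theorem lvGens_mem_adjoinField (M : ℕ) (c : Fin N → F) (j : Fin N ⊕ Fin N) :
    lvGens M c j ∈ IntermediateField.adjoin (fieldOf K) (allGens c) :=
  mem_adjoinField_of_mem_adjoin (lvAlgebra_le_adjoin_allGens K M c (lvGens_mem_lvAlgebra K M c j))

end GammaFieldOf

/-! ### Transport of the type of an algebraic element along a Γ-isomorphism -/

section TypeTransport

variable {c c' : Fin N → F}

/-- **Same type over `K₀` at every level.** Let `θ : ⟨K c⟩ ≅ ⟨K c'⟩` be the field isomorphism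
of a Γ-isomorphism `c ↦ c'` over `K`, `x` integral over `⟨K c⟩` with minimal polynomial `q`, and
`x'` a root of `θ(q)`. Then for every level `M` and every polynomial `P` over `K₀` in variables
for `x` and for `(c, exp (c/M!))`: `P(x, c, exp (c/M!)) = 0 ↔ P(x', c', exp (c'/M!)) = 0`
(substitute the level generators into `P` to get `P̃ ∈ ⟨K c⟩[X]`; then `P̃(x) = 0 ↔ q ∣ P̃ ↔
θ(q) ∣ θ(P̃) ↔ θ(P̃)(x') = 0`, since `θ(q)` is the minimal polynomial of `x'`).
[cite: BaysKirby2018ANT, §4.4 (Thm 4.17, proof)] -/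
theorem IsGammaIso.aeval_sumElim_single_eq_zero_iff (h : IsGammaIso K c c') {x x' : F}
    (hxi : IsIntegral (IntermediateField.adjoin (fieldOf K) (allGens c)) x)
    (hx' : Polynomial.eval₂ ((algebraMap (IntermediateField.adjoin (fieldOf K) (allGens c')) F).comp
      h.fieldEquiv.toRingHom) x'
        (minpoly (IntermediateField.adjoin (fieldOf K) (allGens c)) x) = 0)
    (M : ℕ) (P : MvPolynomial (Fin 1 ⊕ (Fin N ⊕ Fin N)) (fieldOf K)) :
    aeval (Sum.elim ![x] (lvGens M c)) P = 0 ↔ aeval (Sum.elim ![x'] (lvGens M c')) P = 0 := by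
  classical
  set E := IntermediateField.adjoin (fieldOf K) (allGens c) with hE
  set E' := IntermediateField.adjoin (fieldOf K) (allGens c') with hE'
  set θ : E ≃+* E' := h.fieldEquiv with hθ
  set q := minpoly E x with hq
  -- substitution of the level generators: `P ↦ P̃ ∈ E[X]`
  let v : Fin 1 ⊕ (Fin N ⊕ Fin N) → Polynomial E :=
    Sum.elim ![Polynomial.X] fun j => Polynomial.C ⟨lvGens M c j, lvGens_mem_adjoinField M c j⟩
  let v' : Fin 1 ⊕ (Fin N ⊕ Fin N) → Polynomial E' :=
    Sum.elim ![Polynomial.X] fun j => Polynomial.C ⟨lvGens M c' j, lvGens_mem_adjoinField M c' j⟩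
  let Φ : MvPolynomial (Fin 1 ⊕ (Fin N ⊕ Fin N)) (fieldOf K) →ₐ[fieldOf K] Polynomial E := aeval v
  let Φ' : MvPolynomial (Fin 1 ⊕ (Fin N ⊕ Fin N)) (fieldOf K) →ₐ[fieldOf K] Polynomial E' := aeval v'
  -- (α) evaluation compatibility
  have hα : ∀ P, ((Polynomial.aeval x (Φ P) : F)) = aeval (Sum.elim ![x] (lvGens M c)) P := by
    intro P
    have : ((Polynomial.aeval x).restrictScalars (fieldOf K)).comp Φ =
        aeval (Sum.elim ![x] (lvGens M c)) := by
      refine MvPolynomial.algHom_ext fun i => ?_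
      rcases i with i | j
      · simp [Φ, v, Fin.fin_one_eq_zero i]
      · simp [Φ, v]
    exact congrArg (fun f => f P) this
  have hα' : ∀ P, ((Polynomial.aeval x' (Φ' P) : F)) = aeval (Sum.elim ![x'] (lvGens M c')) P := by
    intro P
    have : ((Polynomial.aeval x').restrictScalars (fieldOf K)).comp Φ' =
        aeval (Sum.elim ![x'] (lvGens M c')) := by
      refine MvPolynomial.algHom_ext fun i => ?_
      rcases i with i | j
      · simp [Φ', v', Fin.fin_one_eq_zero i]
      · simp [Φ', v']
    exact congrArg (fun f => f P) this
  -- (β) `θ(P̃) = P̃'`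
  have hθK : ∀ k : fieldOf K, θ (algebraMap (fieldOf K) E k) = algebraMap (fieldOf K) E' k := by
    intro k
    apply Subtype.ext
    exact h.coe_fieldEquiv_algebraMap k
  have hθg : ∀ j, θ ⟨lvGens M c j, lvGens_mem_adjoinField M c j⟩ =
      ⟨lvGens M c' j, lvGens_mem_adjoinField M c' j⟩ := by
    intro j
    apply Subtype.ext
    exact h.coe_fieldEquiv_lvGens M j
  have hβ : ∀ P, (Φ P).map θ.toRingHom = Φ' P := by
    intro P
    have : (Polynomial.mapRingHom θ.toRingHom).comp Φ.toRingHom = Φ'.toRingHom := by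
      refine MvPolynomial.ringHom_ext (fun k => ?_) (fun i => ?_)
      · simp only [RingHom.comp_apply, AlgHom.toRingHom_eq_coe, RingHom.coe_coe, Polynomial.coe_mapRingHom,
          Φ, Φ', MvPolynomial.aeval_C, Polynomial.algebraMap_apply, Polynomial.map_C]
        congr 1
        exact hθK k
      · rcases i with i | j
        · simp [Φ, Φ', v, v', Fin.fin_one_eq_zero i]
        · simp only [RingHom.comp_apply, AlgHom.toRingHom_eq_coe, RingHom.coe_coe,
            Polynomial.coe_mapRingHom, Φ, Φ', v, v', aeval_X, Sum.elim_inr, Polynomial.map_C]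
          rw [show θ.toRingHom ⟨lvGens M c j, lvGens_mem_adjoinField M c j⟩ =
            ⟨lvGens M c' j, lvGens_mem_adjoinField M c' j⟩ from hθg j]
    exact congrArg (fun f => f P) this
  -- (γ) `θ(q)` is the minimal polynomial of `x'`
  have hqirr : Irreducible q := minpoly.irreducible hxi
  have hqm : q.Monic := minpoly.monic hxi
  have hγ : minpoly E' x' = q.map θ.toRingHom := by
    symm
    refine minpoly.eq_of_irreducible_of_monic ?_ ?_ (hqm.map _)
    · have : Polynomial.mapEquiv θ q = q.map θ.toRingHom := Polynomial.mapEquiv_apply θ q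
      rw [← this]
      exact (MulEquiv.irreducible_iff (Polynomial.mapEquiv θ)).2 hqirr
    · rw [Polynomial.aeval_def, Polynomial.eval₂_map]
      exact hx'
  -- (δ) the chain of equivalences
  rw [← hα P, ← hα' P]
  rw [show ((Polynomial.aeval x (Φ P) : F)) = 0 ↔ Polynomial.aeval x (Φ P) = 0 from Iff.rfl,
    show ((Polynomial.aeval x' (Φ' P) : F)) = 0 ↔ Polynomial.aeval x' (Φ' P) = 0 from Iff.rfl,
    ← minpoly.dvd_iff, ← minpoly.dvd_iff, hγ, ← hβ P, ← hq]
  rw [show q.map θ.toRingHom = Polynomial.mapEquiv θ q from (Polynomial.mapEquiv_apply θ q).symm,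
    show (Φ P).map θ.toRingHom = Polynomial.mapEquiv θ (Φ P) from (Polynomial.mapEquiv_apply θ _).symm,
    map_dvd_iff]

/-! ### The algebraic step: `(c, x) ↦ (c', x')` -/

omit [CharZero F] in
/-- The level generators of `(c, x)`, re-indexed as `(exp (x/M!); x; c, exp (c/M!))`. [folklore] -/
theorem lvGens_append_single_eq_comp (M : ℕ) (c : Fin N → F) (x : F) :
    lvGens M (Fin.append c ![x]) =
      Sum.elim ![exp (x / (M.factorial : F))] (Sum.elim ![x] (lvGens M c)) ∘
        (Sum.elim
          (Fin.addCases (fun i => Sum.inr (Sum.inr (Sum.inl i))) fun _ => Sum.inr (Sum.inl 0))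
          (Fin.addCases (fun i => Sum.inr (Sum.inr (Sum.inr i))) fun _ => Sum.inl 0) :
          Fin (N + 1) ⊕ Fin (N + 1) → Fin 1 ⊕ (Fin 1 ⊕ (Fin N ⊕ Fin N))) := by
  funext s
  rcases s with j | j
  · refine Fin.addCases (fun i => ?_) (fun i => ?_) j
    · simp [lvGens]
    · simp [lvGens, Fin.fin_one_eq_zero i]
  · refine Fin.addCases (fun i => ?_) (fun i => ?_) j
    · simp [lvGens]
    · simp [lvGens, Fin.fin_one_eq_zero i]

/-- `K₀[x, c, exp (c/M!)] ⊆ acl (gens (K + ℚc) ∪ {x})`. [folklore] -/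
theorem coe_adjoin_sumElim_single_lvGens_subset_acl (M : ℕ) (c : Fin N → F) (x : F) :
    ((Algebra.adjoin (fieldOf K) (range (Sum.elim ![x] (lvGens M c))) :
        Subalgebra (fieldOf K) F) : Set F) ⊆
      acl (insert x (gens (K ⊔ Submodule.span ℚ (range c)))) := by
  refine algebraAdjoin_subset_acl (fun r => ?_) ?_
  · exact acl_mono ((gens_mono le_sup_left).trans (subset_insert _ _)) (fieldOf_subset_acl K r.2)
  · rintro _ ⟨s, rfl⟩
    rcases s with i | j
    · exact subset_acl _ (by simp [Fin.fin_one_eq_zero i])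
    · exact subset_acl _ (mem_insert_of_mem _ (lvGens_mem_gens K M c j))

/-- If `exp x ∉ acl (gens (K + ℚc) ∪ {x})` then `exp (x/M!)` is algebraically independent (as a
one-element family) over `K₀[x, c, exp (c/M!)]`. [folklore] -/
theorem algebraicIndependent_exp_div_factorial {M : ℕ} {c : Fin N → F} {x : F}
    (hx : exp x ∉ acl (insert x (gens (K ⊔ Submodule.span ℚ (range c))))) :
    AlgebraicIndependent (Algebra.adjoin (fieldOf K) (range (Sum.elim ![x] (lvGens M c))))
      ![exp (x / (M.factorial : F))] := by
  rw [algebraicIndependent_iff_transcendental]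
  refine transcendental_of_not_mem_acl _ (coe_adjoin_sumElim_single_lvGens_subset_acl M c x)
    fun hmem => hx ?_
  have hpow : exp (x / (M.factorial : F)) ^ M.factorial = exp x := by
    have := exp_div_factorial_eq_pow x (Nat.zero_le M)
    simpa using this.symm
  have := zpow_mem_acl hmem (M.factorial : ℤ)
  rwa [zpow_natCast, hpow] at this

/-- **The algebraic step, kernel form.** Let `c ↦ c'` be a Γ-isomorphism over `K` with field
isomorphism `θ : ⟨K c⟩ ≅ ⟨K c'⟩`, `x` integral over `⟨K c⟩` with `exp x` transcendental over
`⟨K c⟩(x)`, and `x'` a root of `θ(minpoly x)` with `exp x'` transcendental over `⟨K c'⟩(x')`. Then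
`(c, x) ↦ (c', x')` is a Γ-isomorphism over `K`: at each level the relation ideal of
`(c, x ; exp (c/M!), exp (x/M!))` is that of `(x ; c, exp (c/M!))` extended by the transcendental
`exp (x/M!)` (`ZilberHomogeneity.ker_aeval_sumElim_eq`). [cite: BaysKirby2018ANT, §4.4 (Thm 4.17, proof)] -/
theorem IsGammaIso.append_single_of_minpoly {c c' : Fin N → F} (h : IsGammaIso K c c') {x x' : F}
    (hxi : IsIntegral (IntermediateField.adjoin (fieldOf K) (allGens c)) x)
    (hx' : Polynomial.eval₂ ((algebraMap (IntermediateField.adjoin (fieldOf K) (allGens c')) F).comp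
      h.fieldEquiv.toRingHom) x'
        (minpoly (IntermediateField.adjoin (fieldOf K) (allGens c)) x) = 0)
    (hex : exp x ∉ acl (insert x (gens (K ⊔ Submodule.span ℚ (range c)))))
    (hex' : exp x' ∉ acl (insert x' (gens (K ⊔ Submodule.span ℚ (range c'))))) :
    IsGammaIso K (Fin.append c ![x]) (Fin.append c' ![x']) := by
  rw [isGammaIso_iff_ker_eq]
  intro M
  have hv : RingHom.ker (aeval (Sum.elim ![x] (lvGens M c)) :
      MvPolynomial (Fin 1 ⊕ (Fin N ⊕ Fin N)) (fieldOf K) →ₐ[fieldOf K] F) =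
      RingHom.ker (aeval (Sum.elim ![x'] (lvGens M c')) :
      MvPolynomial (Fin 1 ⊕ (Fin N ⊕ Fin N)) (fieldOf K) →ₐ[fieldOf K] F) := by
    ext P
    rw [RingHom.mem_ker, RingHom.mem_ker]
    exact h.aeval_sumElim_single_eq_zero_iff hxi hx' M P
  have key := ker_aeval_sumElim_eq hv (algebraicIndependent_exp_div_factorial hex)
    (algebraicIndependent_exp_div_factorial hex')
  rw [lvGens_append_single_eq_comp, lvGens_append_single_eq_comp]
  exact ker_aeval_comp_eq key _

/-- **The algebraic step** (Bays–Kirby 2018, §4.4, proof of Thm 4.17, algebraic case; used in the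
proof of Lemma 8.3 / Prop. 11.2 through "we may assume `A = A^full ∧ B`"). Let `F` be
algebraically closed, `c ↦ c'` a Γ-isomorphism over `K` with `K + ℚc ◁ F` and `K + ℚc' ◁ F`, and
`x ∉ K + ℚc` algebraic over the Γ-field `⟨K c⟩`. Then there is `x' ∉ K + ℚc'`, algebraic over
`⟨K c'⟩`, such that `(c, x) ↦ (c', x')` is a Γ-isomorphism over `K`. (Take for `x'` a root of
the transport of the minimal polynomial of `x`; `exp x`, `exp x'` are transcendental over
`⟨K c⟩(x)`, `⟨K c'⟩(x')` because the subspaces are strong.) [cite: BaysKirby2018ANT, §4.4 (Thm 4.17, proof), Lemma 8.3 (proof)] -/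
theorem IsGammaIso.exists_append_single_of_mem_acl [IsAlgClosed F] {c c' : Fin N → F}
    (h : IsGammaIso K c c') (hs : IsStrong (K ⊔ Submodule.span ℚ (range c)))
    (hs' : IsStrong (K ⊔ Submodule.span ℚ (range c'))) {x : F}
    (hx : x ∈ acl (gens (K ⊔ Submodule.span ℚ (range c)))) (hxX : x ∉ K ⊔ Submodule.span ℚ (range c)) :
    ∃ x' : F, x' ∈ acl (gens (K ⊔ Submodule.span ℚ (range c'))) ∧
      x' ∉ K ⊔ Submodule.span ℚ (range c') ∧
      IsGammaIso K (Fin.append c ![x]) (Fin.append c' ![x']) := by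
  classical
  set E := IntermediateField.adjoin (fieldOf K) (allGens c) with hE
  set E' := IntermediateField.adjoin (fieldOf K) (allGens c') with hE'
  set θ : E ≃+* E' := h.fieldEquiv with hθ
  have hxi : IsIntegral E x := isIntegral_adjoinField_of_mem_acl hx
  set q := minpoly E x with hq
  set q' : Polynomial E' := q.map θ.toRingHom with hq'
  have hqirr : Irreducible q := minpoly.irreducible hxi
  have hq'irr : Irreducible q' := by
    have : Polynomial.mapEquiv θ q = q' := Polynomial.mapEquiv_apply θ q
    rw [← this]
    exact (MulEquiv.irreducible_iff (Polynomial.mapEquiv θ)).2 hqirr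
  have hq'm : q'.Monic := (minpoly.monic hxi).map _
  -- a root of `θ(q)` in `F`
  have hdeg : (q'.map (algebraMap E' F)).degree ≠ 0 := by
    rw [Polynomial.degree_map]
    exact (Polynomial.degree_pos_of_irreducible hq'irr).ne'
  obtain ⟨x', hx'root⟩ := IsAlgClosed.exists_root _ hdeg
  have hx' : Polynomial.eval₂ ((algebraMap E' F).comp θ.toRingHom) x' q = 0 := by
    rw [← Polynomial.eval₂_map, ← hq', ← Polynomial.eval_map]
    exact hx'root
  have hx'q' : Polynomial.aeval x' q' = 0 := by
    rw [Polynomial.aeval_def, hq', Polynomial.eval₂_map]; exact hx'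
  -- `x'` is algebraic over `⟨K c'⟩`
  have hx'alg : IsAlgebraic E' x' := ⟨q', hq'irr.ne_zero, hx'q'⟩
  have hx'acl : x' ∈ acl (gens (K ⊔ Submodule.span ℚ (range c'))) := by
    rw [← acl_coe_adjoinField_eq K c']
    exact mem_acl_coe_of_isAlgebraic E' hx'alg
  -- `x' ∉ K + ℚc'`
  have hx'X : x' ∉ K ⊔ Submodule.span ℚ (range c') := by
    intro hx'X
    have hx'E : x' ∈ E' := mem_adjoinField_of_mem_sup hx'X
    -- `q'` has a root in `E'`, hence degree `1`
    have hroot : q'.IsRoot ⟨x', hx'E⟩ := by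
      have h1 : algebraMap E' F (Polynomial.aeval (⟨x', hx'E⟩ : E') q') = 0 := by
        rw [← Polynomial.aeval_algebraMap_apply F (⟨x', hx'E⟩ : E') q']; exact hx'q'
      have h2 : Polynomial.aeval (⟨x', hx'E⟩ : E') q' = 0 :=
        (algebraMap E' F).injective (by rw [h1, map_zero])
      rwa [Polynomial.coe_aeval_eq_eval] at h2
    have hdeg1 : q'.degree = 1 := Polynomial.degree_eq_one_of_irreducible_of_root hq'irr hroot
    have hdegq : q.degree = 1 := by
      rw [hq', Polynomial.degree_map] at hdeg1; exact hdeg1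
    obtain ⟨e, he⟩ := minpoly.mem_range_of_degree_eq_one E x hdegq
    -- then `x = e ∈ E`, `q = X - e`, `x' = θ e`, and `θ⁻¹ x' = x ∈ K + ℚc`
    have hxe : x = (e : F) := he.symm
    have hqe : q = Polynomial.X - Polynomial.C e := by
      rw [hq, hxe]; exact minpoly.eq_X_sub_C (B := F) e
    have hx'e : x' = (θ e : F) := by
      have := hx'q'
      rw [hq', hqe, Polynomial.map_sub, Polynomial.map_X, Polynomial.map_C, map_sub, Polynomial.aeval_X,
        Polynomial.aeval_C, sub_eq_zero] at this
      exact this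
    have hback : (h.fieldEquiv.symm ⟨x', hx'E⟩ : F) ∈ K ⊔ Submodule.span ℚ (range c) := by
      rw [h.coe_fieldEquiv_symm_eq, h.symm.coe_fieldEquiv_eq_transport hx'X]
      exact h.symm.transport_mem hx'X
    have hsymm : h.fieldEquiv.symm ⟨x', hx'E⟩ = e := by
      apply h.fieldEquiv.injective
      rw [RingEquiv.apply_symm_apply]
      exact Subtype.ext hx'e
    rw [hsymm, ← hxe] at hback
    exact hxX hback
  refine ⟨x', hx'acl, hx'X, h.append_single_of_minpoly hxi hx' ?_ ?_⟩
  · exact exp_not_mem_acl_of_mem_acl hs hx hxX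
  · exact exp_not_mem_acl_of_mem_acl hs' hx'acl hx'X

end TypeTransport

end GammaField

end Literature.NumberTheory.Transcendental
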